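import Summits.QuantumFields.BalabanUV.T4Continuum.Support.NE7ConvOneStepGenericSliceTangent
import Summits.QuantumFields.BalabanUV.T4Continuum.Support.NE7OneStepOfPathOpen
import Summits.QuantumFields.BalabanUV.T4Continuum.Support.NE7RepWGaugeOfDecomposition
import HarnessLib

/-!
# NE7OneStepGenericSlicePath — F20 (`NE7OneStepOfPathOpen` §2–§3) AND F326 §1 (`NE7RepWGaugeOfDecomposition.hrep_of_hdecomp`) OVER AN ABSTRACT SLICE FAMILY `𝒯 k W`:
# ONE-STEP ⇐ PATH ∧ OPEN ∧ REP over `𝒯`, the `hrep` binder from the honest per-pair binder `hdecomp` over `𝒯` with k-free currencies, and the SU(2) `d = 4` `L = 2` instance for the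
# corner-free energy block-Landau slice `𝒯_E = energyBlockLandauW` — files 4–5 of the END re-thread (memo ROAD-G99 §3.5 ∕ §3.8 (C))

Cell `pub-balaban`, rung (B)+1 sub-cell t4, lineage `b2b-balaban-t4-ne7-p1`, generation 99 (CRUX PROVER NE7 #1 = OWNER of BINDER row NE7); over gen 99's templates
`NE7ConvOneStepGenericSlice` (p754830) and `NE7ConvOneStepGenericSliceTangent` (p755239).

WHY.  F20's `oneStep_of_path_open_repW` (ONE-STEP at every level from a data PATH, the local continuation OPEN and the universal representation REP_w) and F326's
`hrep_of_hdecomp` (the `hrep` binder of F28∕F29 from the per-pair decomposition with k-free currencies `sup‖X‖·M ≤ α̂`, `ν ≤ ν̂`, `κ ≤ κ̂` and ONE k-free strict line)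
hardcode `X_T ∈ T_♮(U♯) = frameFreeBlockLandauW L N (k+1) U♯`.  The Bałaban-slice road (memo §3) runs the same chain over `𝒯_E(U♯) = energyBlockLandauW`; as in the two
templates the re-issue is GENERIC in a slice family `𝒯 : ℕ → cfg → Set dir` with (hT) «tangent-critical ⟹ critical on `𝒯 j W`» and (hP) «class SlicePoincare for `𝒯 j W`».
WHAT ([folklore]; 0 def, 0 sorry).
§1 **`oneStep_of_path_open_rep_generic`** — F20 §2 with `T_♮ ↦ 𝒯`: the `hstep` binder of `NE7InteriorInduction.interior_exists_all_levels` from PATH (`γ` continuous on `[0,1]`,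
   `γ 1 = V`, flat admissible start at every level), OPEN (local continuation of small tangent-critical admissible configurations along `γ`), REP over `𝒯` stated universally,
   (hT), (hP), the `LevelSmall` family and the class smallness of `MinimalActionCompact`; proof of record verbatim with F19's class theorem replaced by
   `NE7ConvOneStepGenericSliceTangent.isMinimiser_of_tanCritical_rep_generic`.
§2 **`hrep_body_of_decomp_generic`**, **`hrep_of_hdecomp_generic`** — F326 §1 with `T_♮ ↦ 𝒯 k U♯`: the per-pair decomposition `U′^{u} = U♯e^{X}`, `X = X_T + X_N`, `X_T ∈ 𝒯 k U♯`,
   the two energy letters and the k-free currencies, under the k-free line at the ceilings `(α̂, ν̂, κ̂)` (F326's `kfree_line_mono`, F30's `line_of_kfree_line` BY NAME) ⟹ the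
   `hrep` body with the per-level STRICT line — the junction where the 𝒯_E SUPPLIER (memo §3.8 (B): letter + nonlinear slice theorem) plugs in.
§3 **`oneStep_SU2_of_path_open_repE`** — F20 §3's SU(2) case with `T_♮ ↦ 𝒯_E`, `CPLine + 1 ↦ 8·CPLine + 1`: ONE-STEP at `d = 4`, `L = 2`, `card n = 2`, `0 < ε ≤ 10⁻⁵³`, `0 ≤ δ`
   ⇐ PATH ∧ OPEN ∧ REP over `𝒯_E` — (hT) by `hT_energyBlockLandau`, (hP) by `classSlicePoincare_energyBlockLandau_SU2`, level family `levelSmall_all_d4_L2`, class smallness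
   `classSmall_d4_L2`, nothing else.
HONEST FRAMING (page 1): composition over HYPOTHESES (PATH, OPEN, REP over `𝒯` ∕ `hdecomp` over `𝒯`); for `𝒯_E` at SU(2) the slice hypotheses are theorems of the tree; the supplier
of REP over `𝒯_E` is NOT proved; nothing of Bałaban's asserted; NOT ONE-STEP unconditionally, NOT NE7; spine 0∕9; finite T⁴ rung (B)+1 — NOT infinite volume, NOT mass gap,
NOT BetaPertH, NOT Clay.  Continuum YM on T⁴ ⇐ BetaPertH ∧ nine spine estimates (0/9 proved); BetaPertH ⇐ (D1) ∧ (D4) ∧ CAP+tail; G-an2-4 gates asym, D1 and NE2/3/4.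
-/

set_option autoImplicit false

open scoped BigOperators Matrix Matrix.Norms.L2Operator Topology
open NormedSpace Finset Set Filter

namespace Summit.QuantumFields.BalabanUV.T4Continuum.NE7OneStepGenericSlicePath

open Literature.MathematicalPhysics.QuantumFieldTheory.Balaban1983to89
open B7Prop1Explicit B7Prop2Explicit MatrixLog UnitaryModel
open T4AveragingDeficitWall (IsUnitaryCfg IsSkewDir SmallField vary curl curlSq dirSq Plaq)
open T4AveragingDeficitWallBoundary (IsPeriodicCfg periodBox)
open AveragingDeficitPeriodicCounting (IsPeriodicDir)
open AveragingDeficitMultiLevelPrep (tower LevelSmall TangentIter)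
open MinimalActionLevels (levelAction perWin)
open MinimalActionSandwich (IsMinimiser admissible)
open MinimalActionRate (sfClass)
open NE3HessForm (dAction)
open NE3SlicePoincareShape (SlicePoincare slicePoincare_mono)
open NE3EnergyWeightedShapes (energyNormW)
open NE3EnergyShapes (IsUnitarySite)
open NE3SlicePoincareBudgetLine (CPLine)
open NE3ClassRadiusFamily (CPLine_nonneg_d4_L2)
open NE7ConvOneStepSU2 (levelSmall_all_d4_L2)
open NE7CritClosed (critOneStep_tan_of_continuity)
open NE7OneStepOfPathOpen (tanCritical_of_flat classSmall_d4_L2)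
open NE7RepWGaugeOfRoutePi (line_of_kfree_line)
open NE7RepWGaugeOfDecomposition (kfree_line_mono)
open NE7MeanZeroGaugeSliceW (energyBlockLandauW)
open NE7EnergyBlockLandauClassPoincare (classSlicePoincare_energyBlockLandau_SU2)
open NE7ConvOneStepGenericSlice (hT_energyBlockLandau)
open NE7ConvOneStepGenericSliceTangent (isMinimiser_of_tanCritical_rep_generic)

noncomputable section

variable {d : ℕ} {n : Type*} [Fintype n] [DecidableEq n]

/-! ## §1 ONE-STEP from PATH ∧ OPEN ∧ REP over an abstract slice family -/

/-- **ONE-STEP ⇐ PATH ∧ OPEN ∧ REP OVER `𝒯`** (F20's `oneStep_of_path_open_repW` with `T_♮ ↦ 𝒯`; generic `d`, `L ≥ 2`, `N ≥ 1`; class smallness `16C₀ε ≤ 3`,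
`1024(d+1)(d+4)L²ε ≤ 1`; `LevelSmall` family; (hT), (hP) with constant `CP`).  The competitor of the binder is unused: existence comes from the path. [folklore] -/
theorem oneStep_of_path_open_rep_generic [Nonempty n] {L N : ℕ} [NeZero L] [NeZero N] (hL : 2 ≤ L) (hN : 1 ≤ N) {ε δ CP : ℝ} (hε0 : 0 ≤ ε)
    (hε1 : 16 * C0 d * ε ≤ 3) (hε2 : 1024 * (d + 1) * (d + 4) * (L : ℝ) ^ 2 * ε ≤ 1) (hδ : 0 ≤ δ) (hCP : 0 < CP)
    (hls : ∀ k : ℕ, LevelSmall d L k (ε / ((L : ℝ) ^ (k + 1)) ^ 2))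
    (𝒯 : ℕ → (Site d → Fin d → (Matrix n n ℂ)ˣ) → Set (Site d → Fin d → Matrix n n ℂ))
    (hT : ∀ (j : ℕ) (W : Site d → Fin d → (Matrix n n ℂ)ˣ), W ∈ sfClass d L N ε (j + 1) → ∀ F : Finset (Plaq d),
      (∀ φ : Site d → Fin d → Matrix n n ℂ, IsSkewDir φ → IsPeriodicDir φ ((tower L N (j + 1) : ℕ) : ℤ) → TangentIter L j W φ → dAction W φ F = 0) →
      ∀ Y ∈ 𝒯 j W, dAction W Y F = 0)
    (hP : ∀ (j : ℕ) (W : Site d → Fin d → (Matrix n n ℂ)ˣ), W ∈ sfClass d L N ε (j + 1) →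
      SlicePoincare L (j + 1) W (𝒯 j W) CP (periodBox (d := d) (N * L ^ (j + 1))))
    {V : Site d → Fin d → (Matrix n n ℂ)ˣ} (γ : ℝ → (Site d → Fin d → (Matrix n n ℂ)ˣ)) (hγ : ContinuousOn γ (Icc (0 : ℝ) 1))
    (h0 : ∀ k : ℕ, ∃ U₀ : Site d → Fin d → (Matrix n n ℂ)ˣ, U₀ ∈ admissible (sfClass d L N ε) L (k + 1) (γ 0) ∧ SmallField U₀ 0)
    (hγ1 : γ 1 = V)
    (hopen : ∀ (k : ℕ), ∀ τ₀ ∈ Icc (0 : ℝ) 1,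
      (∃ U : Site d → Fin d → (Matrix n n ℂ)ˣ, U ∈ admissible (sfClass d L N ε) L (k + 1) (γ τ₀) ∧ SmallField U (δ / ((L : ℝ) ^ (k + 1)) ^ 2) ∧
        ∀ φ : Site d → Fin d → Matrix n n ℂ, IsSkewDir φ → IsPeriodicDir φ ((N * L ^ (k + 1) : ℕ) : ℤ) → TangentIter L k U φ →
          dAction U φ (perWin d (N * L ^ (k + 1))) = 0) →
      ∃ ρ : ℝ, 0 < ρ ∧ ∀ τ ∈ Icc (0 : ℝ) 1, |τ - τ₀| < ρ →
        ∃ U : Site d → Fin d → (Matrix n n ℂ)ˣ, U ∈ admissible (sfClass d L N ε) L (k + 1) (γ τ) ∧ SmallField U (δ / ((L : ℝ) ^ (k + 1)) ^ 2) ∧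
          ∀ φ : Site d → Fin d → Matrix n n ℂ, IsSkewDir φ → IsPeriodicDir φ ((N * L ^ (k + 1) : ℕ) : ℤ) → TangentIter L k U φ →
            dAction U φ (perWin d (N * L ^ (k + 1))) = 0)
    (hrepU : ∀ (k : ℕ) (Us : Site d → Fin d → (Matrix n n ℂ)ˣ), Us ∈ admissible (sfClass d L N ε) L (k + 1) V →
      SmallField Us (δ / ((L : ℝ) ^ (k + 1)) ^ 2) →
      (∀ φ : Site d → Fin d → Matrix n n ℂ, IsSkewDir φ → IsPeriodicDir φ ((N * L ^ (k + 1) : ℕ) : ℤ) → TangentIter L k Us φ →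
        dAction Us φ (perWin d (N * L ^ (k + 1))) = 0) →
      ∀ U' ∈ admissible (sfClass d L N ε) L (k + 1) V, ∃ (X XT XN : Site d → Fin d → Matrix n n ℂ) (α ν κ₁ : ℝ),
        IsSkewDir X ∧ IsPeriodicDir X ((N * L ^ (k + 1) : ℕ) : ℤ) ∧ 0 ≤ α ∧ (∀ x μ, ‖X x μ‖ ≤ α) ∧
        levelAction d L N (k + 1) (vary Us X 1) ≤ levelAction d L N (k + 1) U' ∧
        SmallField (vary Us X 1) (ε / ((L : ℝ) ^ (k + 1)) ^ 2) ∧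
        X = XT + XN ∧ XT ∈ 𝒯 k Us ∧ IsSkewDir XN ∧ 0 ≤ ν ∧
        energyNormW L (k + 1) Us XN (periodBox (d := d) (N * L ^ (k + 1)))
          ≤ ν * energyNormW L (k + 1) Us X (periodBox (d := d) (N * L ^ (k + 1))) ∧
        ε / ((L : ℝ) ^ (k + 1)) ^ 2 * (∑ p ∈ perWin d (N * L ^ (k + 1)), ‖curl Us XN p‖)
          ≤ κ₁ * energyNormW L (k + 1) Us X (periodBox (d := d) (N * L ^ (k + 1))) ^ 2 ∧
        2 * κ₁ ≤ ((((1 / 2 - ν ^ 2) / (2 * (1 + CP)) - ν ^ 2) / 2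
            - 576 * d * (Real.exp α - 1) ^ 2 * ((L : ℝ) ^ (k + 1)) ^ 2) / (Fintype.card n : ℝ)
            - 28 * d * (ε / ((L : ℝ) ^ (k + 1)) ^ 2 + 7 * α ^ 2) * ((L : ℝ) ^ (k + 1)) ^ 2)) :
    ∀ (k : ℕ) (U₀ : Site d → Fin d → (Matrix n n ℂ)ˣ), U₀ ∈ admissible (sfClass d L N ε) L (k + 1) V →
      SmallField U₀ (δ / ((L : ℝ) ^ k) ^ 2) →
      ∃ U, IsMinimiser d (sfClass d L N ε) L N (k + 1) V U ∧ SmallField U (δ / ((L : ℝ) ^ (k + 1)) ^ 2) := by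
  have hL1 : 1 ≤ L := by omega
  intro k _ _ _
  have hr : 0 ≤ δ / ((L : ℝ) ^ (k + 1)) ^ 2 := by positivity
  obtain ⟨U₀, hU₀, hfl⟩ := h0 k
  have h0' := tanCritical_of_flat (r := δ / ((L : ℝ) ^ (k + 1)) ^ 2) hr hU₀ hfl
  obtain ⟨Us, hmem, hUsr, hcritT⟩ :=
    critOneStep_tan_of_continuity hL hε0 hε1 hε2 (hls k) γ hγ h0' (hopen k) 1 ⟨zero_le_one, le_rfl⟩
  rw [hγ1] at hmem
  exact ⟨Us, isMinimiser_of_tanCritical_rep_generic hL1 hN hε0 hCP 𝒯 hT hP hmem hcritT (hrepU k Us hmem hUsr hcritT), hUsr⟩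

/-! ## §2 The `hrep` binder from the honest per-pair binder `hdecomp` over `𝒯`, k-free currencies -/

/-- **F29's `hrep` BODY FROM THE DECOMPOSITION DATA OVER `𝒯` WITH k-FREE CURRENCIES** (F326's `hrep_body_of_decomp` with `T_♮ ↦ 𝒯 k U♯`; level `k+1`, `M = L^{k+1}`, `L ≥ 1`):
`u` unitary, `X` skew `(N·M)`-periodic with `sup ≤ α`, `U′^{u} = U♯·e^{X}`, `X = X_T + X_N`, `X_T ∈ 𝒯 k U♯`, `X_N` skew, `‖X_N‖_w ≤ ν‖X‖_w`, `(ε∕M²)·Σ‖curl X_N‖ ≤ κ‖X‖_w²`,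
currencies `αM ≤ α̂`, `0 ≤ ν ≤ ν̂`, `κ ≤ κ̂`, and the k-free line at `(α̂, ν̂, κ̂)` ⟹ the `hrep` body with the per-level STRICT line at `(α, ν, κ)`. [folklore] -/
theorem hrep_body_of_decomp_generic {L N : ℕ} (hL : 1 ≤ L) (k : ℕ) {ε αh νh κh CP : ℝ} (hCP : 0 < 1 + CP) (hcard : 0 < (Fintype.card n : ℝ))
    (hline : 2 * κh < ((((1 / 2 - νh ^ 2) / (2 * (1 + CP)) - νh ^ 2) / 2 - 576 * d * (αh ^ 2 * Real.exp (2 * αh))) / (Fintype.card n : ℝ)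
        - 28 * d * (ε + 7 * αh ^ 2)))
    (𝒯 : ℕ → (Site d → Fin d → (Matrix n n ℂ)ˣ) → Set (Site d → Fin d → Matrix n n ℂ))
    {Us U' : Site d → Fin d → (Matrix n n ℂ)ˣ} {u : Site d → (Matrix n n ℂ)ˣ} {X XT XN : Site d → Fin d → Matrix n n ℂ} {α ν κ : ℝ}
    (hu : IsUnitarySite u) (hXs : IsSkewDir X) (hXP : IsPeriodicDir X ((N * L ^ (k + 1) : ℕ) : ℤ)) (hα : 0 ≤ α) (hsup : ∀ x μ, ‖X x μ‖ ≤ α)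
    (hrep : gaugeAct u U' = vary Us X 1) (hX : X = XT + XN) (hXT : XT ∈ 𝒯 k Us) (hNs : IsSkewDir XN)
    (hν0 : 0 ≤ ν)
    (hN1 : energyNormW L (k + 1) Us XN (periodBox (d := d) (N * L ^ (k + 1))) ≤ ν * energyNormW L (k + 1) Us X (periodBox (d := d) (N * L ^ (k + 1))))
    (hN2 : ε / ((L : ℝ) ^ (k + 1)) ^ 2 * (∑ p ∈ perWin d (N * L ^ (k + 1)), ‖curl Us XN p‖)
      ≤ κ * energyNormW L (k + 1) Us X (periodBox (d := d) (N * L ^ (k + 1))) ^ 2)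
    (hcur : α * (L : ℝ) ^ (k + 1) ≤ αh) (hνh : ν ≤ νh) (hκh : κ ≤ κh) :
    ∃ (u : Site d → (Matrix n n ℂ)ˣ) (X XT XN : Site d → Fin d → Matrix n n ℂ) (α ν κ₁ : ℝ),
      IsUnitarySite u ∧ IsSkewDir X ∧ IsPeriodicDir X ((N * L ^ (k + 1) : ℕ) : ℤ) ∧ 0 ≤ α ∧ (∀ x μ, ‖X x μ‖ ≤ α) ∧
      gaugeAct u U' = vary Us X 1 ∧
      X = XT + XN ∧ XT ∈ 𝒯 k Us ∧ IsSkewDir XN ∧ 0 ≤ ν ∧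
      energyNormW L (k + 1) Us XN (periodBox (d := d) (N * L ^ (k + 1)))
        ≤ ν * energyNormW L (k + 1) Us X (periodBox (d := d) (N * L ^ (k + 1))) ∧
      ε / ((L : ℝ) ^ (k + 1)) ^ 2 * (∑ p ∈ perWin d (N * L ^ (k + 1)), ‖curl Us XN p‖)
        ≤ κ₁ * energyNormW L (k + 1) Us X (periodBox (d := d) (N * L ^ (k + 1))) ^ 2 ∧
      2 * κ₁ < ((((1 / 2 - ν ^ 2) / (2 * (1 + CP)) - ν ^ 2) / 2
          - 576 * d * (Real.exp α - 1) ^ 2 * ((L : ℝ) ^ (k + 1)) ^ 2) / (Fintype.card n : ℝ)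
          - 28 * d * (ε / ((L : ℝ) ^ (k + 1)) ^ 2 + 7 * α ^ 2) * ((L : ℝ) ^ (k + 1)) ^ 2) := by
  have hl1 := kfree_line_mono (n := n) (d := d) (αh := αh) (ε := ε) hν0 hνh hκh hCP hcard hline
  have hl2 := line_of_kfree_line (n := n) (d := d) hL k hα hcur hcard hl1
  exact ⟨u, X, XT, XN, α, ν, κ, hu, hXs, hXP, hα, hsup, hrep, hX, hXT, hNs, hν0, hN1, hN2, hl2⟩

/-- **THE `hrep` BINDER OF THE ONE-STEP END OVER `𝒯` FROM THE HONEST PER-PAIR BINDER `hdecomp` OVER `𝒯`** (F326's `hrep_of_hdecomp` with `T_♮ ↦ 𝒯 k U♯`), over any class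
tower `𝒞`, data class `𝒟` and side conditions `P k D U♯` (`L ≥ 1`, `0 < 1 + CP`; uniformly ONE k-free strict line at the ceilings `(α̂, ν̂, κ̂)`): per pair `(U♯, U′)` the
decomposition `U′^{u} = U♯e^{X}`, `X = X_T + X_N`, `X_T ∈ 𝒯 k U♯`, with its two energy letters and the currencies `sup‖X‖·L^{k+1} ≤ α̂`, `ν ≤ ν̂`, `κ ≤ κ̂` — THE JUNCTION WHERE THE
`𝒯_E` SUPPLIER PLUGS IN (memo §3.8 (B)). [folklore] -/
theorem hrep_of_hdecomp_generic [Nonempty n] {L N : ℕ} (hL : 1 ≤ L) {ε αh νh κh CP : ℝ} (hCP : 0 < 1 + CP)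
    (hline : 2 * κh < ((((1 / 2 - νh ^ 2) / (2 * (1 + CP)) - νh ^ 2) / 2 - 576 * d * (αh ^ 2 * Real.exp (2 * αh))) / (Fintype.card n : ℝ)
        - 28 * d * (ε + 7 * αh ^ 2)))
    (𝒯 : ℕ → (Site d → Fin d → (Matrix n n ℂ)ˣ) → Set (Site d → Fin d → Matrix n n ℂ))
    {𝒞 : ℕ → Set (Site d → Fin d → (Matrix n n ℂ)ˣ)}
    {𝒟 : Set (Site d → Fin d → (Matrix n n ℂ)ˣ)} {P : ℕ → (Site d → Fin d → (Matrix n n ℂ)ˣ) → (Site d → Fin d → (Matrix n n ℂ)ˣ) → Prop}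
    (hdecomp : ∀ D ∈ 𝒟, ∀ (k : ℕ), ∀ Us ∈ admissible 𝒞 L (k + 1) D, P k D Us →
      ∀ U' ∈ admissible 𝒞 L (k + 1) D,
      ∃ (u : Site d → (Matrix n n ℂ)ˣ) (X XT XN : Site d → Fin d → Matrix n n ℂ) (α ν κ : ℝ),
        IsUnitarySite u ∧ IsSkewDir X ∧ IsPeriodicDir X ((N * L ^ (k + 1) : ℕ) : ℤ) ∧ 0 ≤ α ∧ (∀ x μ, ‖X x μ‖ ≤ α) ∧
        gaugeAct u U' = vary Us X 1 ∧
        X = XT + XN ∧ XT ∈ 𝒯 k Us ∧ IsSkewDir XN ∧ 0 ≤ ν ∧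
        energyNormW L (k + 1) Us XN (periodBox (d := d) (N * L ^ (k + 1)))
          ≤ ν * energyNormW L (k + 1) Us X (periodBox (d := d) (N * L ^ (k + 1))) ∧
        ε / ((L : ℝ) ^ (k + 1)) ^ 2 * (∑ p ∈ perWin d (N * L ^ (k + 1)), ‖curl Us XN p‖)
          ≤ κ * energyNormW L (k + 1) Us X (periodBox (d := d) (N * L ^ (k + 1))) ^ 2 ∧
        α * (L : ℝ) ^ (k + 1) ≤ αh ∧ ν ≤ νh ∧ κ ≤ κh) :
    ∀ D ∈ 𝒟, ∀ (k : ℕ), ∀ Us ∈ admissible 𝒞 L (k + 1) D, P k D Us →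
      ∀ U' ∈ admissible 𝒞 L (k + 1) D, ∃ (u : Site d → (Matrix n n ℂ)ˣ) (X XT XN : Site d → Fin d → Matrix n n ℂ)
        (α ν κ₁ : ℝ), IsUnitarySite u ∧ IsSkewDir X ∧ IsPeriodicDir X ((N * L ^ (k + 1) : ℕ) : ℤ) ∧ 0 ≤ α ∧ (∀ x μ, ‖X x μ‖ ≤ α) ∧
        gaugeAct u U' = vary Us X 1 ∧
        X = XT + XN ∧ XT ∈ 𝒯 k Us ∧ IsSkewDir XN ∧ 0 ≤ ν ∧
        energyNormW L (k + 1) Us XN (periodBox (d := d) (N * L ^ (k + 1)))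
          ≤ ν * energyNormW L (k + 1) Us X (periodBox (d := d) (N * L ^ (k + 1))) ∧
        ε / ((L : ℝ) ^ (k + 1)) ^ 2 * (∑ p ∈ perWin d (N * L ^ (k + 1)), ‖curl Us XN p‖)
          ≤ κ₁ * energyNormW L (k + 1) Us X (periodBox (d := d) (N * L ^ (k + 1))) ^ 2 ∧
        2 * κ₁ < ((((1 / 2 - ν ^ 2) / (2 * (1 + CP)) - ν ^ 2) / 2
            - 576 * d * (Real.exp α - 1) ^ 2 * ((L : ℝ) ^ (k + 1)) ^ 2) / (Fintype.card n : ℝ)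
            - 28 * d * (ε / ((L : ℝ) ^ (k + 1)) ^ 2 + 7 * α ^ 2) * ((L : ℝ) ^ (k + 1)) ^ 2) := by
  intro D hD k Us hUs hPk U' hU'
  obtain ⟨u, X, XT, XN, α, ν, κ, hu, hXs, hXP, hα, hsup, hrep, hX, hXT, hNs, hν0, hN1, hN2, hcur, hνh, hκh⟩ :=
    hdecomp D hD k Us hUs hPk U' hU'
  have hcard : 0 < (Fintype.card n : ℝ) := by exact_mod_cast Fintype.card_pos
  exact hrep_body_of_decomp_generic hL k hCP hcard hline 𝒯 hu hXs hXP hα hsup hrep hX hXT hNs hν0 hN1 hN2 hcur hνh hκh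

/-! ## §3 Instance: ONE-STEP ⇐ PATH ∧ OPEN ∧ REP over `𝒯_E`, `d = 4`, `L = 2`, SU(2) -/

/-- **ONE-STEP AT `d = 4`, `L = 2`, SU(2)∕U(2) (`card n = 2`), `0 < ε ≤ 10⁻⁵³`, `0 ≤ δ`, FROM PATH ∧ OPEN ∧ REP OVER `𝒯_E = energyBlockLandauW` ONLY** (F20 §3's
`oneStep_SU2_of_path_open_repW` with `T_♮ ↦ 𝒯_E`, constant of record `8·CPLine 4 2 2 10⁻¹⁷ 10⁻⁵³ + 1`; the path starts at a datum with flat admissible lifts, e.g. `flatCfg`). [folklore] -/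
theorem oneStep_SU2_of_path_open_repE [Nonempty n] (hn : Fintype.card n = 2) {N : ℕ} [NeZero N] (hN : 1 ≤ N) {ε δ : ℝ} (hε : 0 < ε)
    (hε' : ε ≤ 1 / 10 ^ 53) (hδ : 0 ≤ δ) {V : Site 4 → Fin 4 → (Matrix n n ℂ)ˣ}
    (γ : ℝ → (Site 4 → Fin 4 → (Matrix n n ℂ)ˣ)) (hγ : ContinuousOn γ (Icc (0 : ℝ) 1))
    (h0 : ∀ k : ℕ, ∃ U₀ : Site 4 → Fin 4 → (Matrix n n ℂ)ˣ, U₀ ∈ admissible (sfClass 4 2 N ε) 2 (k + 1) (γ 0) ∧ SmallField U₀ 0) (hγ1 : γ 1 = V)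
    (hopen : ∀ (k : ℕ), ∀ τ₀ ∈ Icc (0 : ℝ) 1,
      (∃ U : Site 4 → Fin 4 → (Matrix n n ℂ)ˣ, U ∈ admissible (sfClass 4 2 N ε) 2 (k + 1) (γ τ₀) ∧ SmallField U (δ / (((2 : ℕ) : ℝ) ^ (k + 1)) ^ 2) ∧
        ∀ φ : Site 4 → Fin 4 → Matrix n n ℂ, IsSkewDir φ → IsPeriodicDir φ ((N * 2 ^ (k + 1) : ℕ) : ℤ) → TangentIter 2 k U φ →
          dAction U φ (perWin 4 (N * 2 ^ (k + 1))) = 0) →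
      ∃ ρ : ℝ, 0 < ρ ∧ ∀ τ ∈ Icc (0 : ℝ) 1, |τ - τ₀| < ρ →
        ∃ U : Site 4 → Fin 4 → (Matrix n n ℂ)ˣ, U ∈ admissible (sfClass 4 2 N ε) 2 (k + 1) (γ τ) ∧ SmallField U (δ / (((2 : ℕ) : ℝ) ^ (k + 1)) ^ 2) ∧
          ∀ φ : Site 4 → Fin 4 → Matrix n n ℂ, IsSkewDir φ → IsPeriodicDir φ ((N * 2 ^ (k + 1) : ℕ) : ℤ) → TangentIter 2 k U φ →
            dAction U φ (perWin 4 (N * 2 ^ (k + 1))) = 0)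
    (hrepU : ∀ (k : ℕ) (Us : Site 4 → Fin 4 → (Matrix n n ℂ)ˣ), Us ∈ admissible (sfClass 4 2 N ε) 2 (k + 1) V →
      SmallField Us (δ / (((2 : ℕ) : ℝ) ^ (k + 1)) ^ 2) →
      (∀ φ : Site 4 → Fin 4 → Matrix n n ℂ, IsSkewDir φ → IsPeriodicDir φ ((N * 2 ^ (k + 1) : ℕ) : ℤ) → TangentIter 2 k Us φ →
        dAction Us φ (perWin 4 (N * 2 ^ (k + 1))) = 0) →
      ∀ U' ∈ admissible (sfClass 4 2 N ε) 2 (k + 1) V, ∃ (X XT XN : Site 4 → Fin 4 → Matrix n n ℂ) (α ν κ₁ : ℝ),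
        IsSkewDir X ∧ IsPeriodicDir X ((N * 2 ^ (k + 1) : ℕ) : ℤ) ∧ 0 ≤ α ∧ (∀ x μ, ‖X x μ‖ ≤ α) ∧
        levelAction 4 2 N (k + 1) (vary Us X 1) ≤ levelAction 4 2 N (k + 1) U' ∧
        SmallField (vary Us X 1) (ε / (((2 : ℕ) : ℝ) ^ (k + 1)) ^ 2) ∧
        X = XT + XN ∧ XT ∈ energyBlockLandauW (d := 4) (n := n) 2 N (k + 1) Us ∧ IsSkewDir XN ∧ 0 ≤ ν ∧
        energyNormW 2 (k + 1) Us XN (periodBox (d := 4) (N * 2 ^ (k + 1)))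
          ≤ ν * energyNormW 2 (k + 1) Us X (periodBox (d := 4) (N * 2 ^ (k + 1))) ∧
        ε / (((2 : ℕ) : ℝ) ^ (k + 1)) ^ 2 * (∑ p ∈ perWin 4 (N * 2 ^ (k + 1)), ‖curl Us XN p‖)
          ≤ κ₁ * energyNormW 2 (k + 1) Us X (periodBox (d := 4) (N * 2 ^ (k + 1))) ^ 2 ∧
        2 * κ₁ ≤ ((((1 / 2 - ν ^ 2) / (2 * (1 + (8 * CPLine 4 2 2 (1 / 10 ^ 17) (1 / 10 ^ 53) + 1))) - ν ^ 2) / 2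
            - 576 * (4 : ℕ) * (Real.exp α - 1) ^ 2 * ((((2 : ℕ) : ℝ)) ^ (k + 1)) ^ 2) / (Fintype.card n : ℝ)
            - 28 * (4 : ℕ) * (ε / (((2 : ℕ) : ℝ) ^ (k + 1)) ^ 2 + 7 * α ^ 2) * ((((2 : ℕ) : ℝ)) ^ (k + 1)) ^ 2)) :
    ∀ (k : ℕ) (U₀ : Site 4 → Fin 4 → (Matrix n n ℂ)ˣ), U₀ ∈ admissible (sfClass 4 2 N ε) 2 (k + 1) V →
      SmallField U₀ (δ / (((2 : ℕ) : ℝ) ^ k) ^ 2) →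
      ∃ U, IsMinimiser 4 (sfClass 4 2 N ε) 2 N (k + 1) V U ∧ SmallField U (δ / (((2 : ℕ) : ℝ) ^ (k + 1)) ^ 2) := by
  have hCP : 0 < 8 * CPLine 4 2 2 (1 / 10 ^ 17) (1 / 10 ^ 53) + 1 := by linarith [CPLine_nonneg_d4_L2]
  have hls := levelSmall_all_d4_L2 hε.le (hε'.trans (by norm_num))
  obtain ⟨hε1, hε2⟩ := classSmall_d4_L2 hε'
  exact oneStep_of_path_open_rep_generic (d := 4) (by norm_num) hN hε.le hε1 hε2 hδ hCP hls
    (fun j W => energyBlockLandauW (d := 4) (n := n) 2 N (j + 1) W)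
    (fun j W hW F htan => hT_energyBlockLandau (by norm_num) hε.le hls j W hW F htan)
    (fun j W hW => slicePoincare_mono (classSlicePoincare_energyBlockLandau_SU2 hn hN hε hε' j W hW) (by linarith)) γ hγ h0 hγ1 hopen hrepU

end

end Summit.QuantumFields.BalabanUV.T4Continuum.NE7OneStepGenericSlicePath
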